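import Summits.BirchSwinnertonDyer.BirchSwinnertonDyer.Theorems.SignedBaseChangeAnticyclotomicEisensteinDivisibilityGreenbergFullAtSqueeze
import Summits.BirchSwinnertonDyer.BirchSwinnertonDyer.Theorems.EisensteinPrimesAcTwistDeformationLEOOfTateTC
import Literature.NumberTheory.IwasawaTheory.Greenberg2006.CohomologyCofiniteGenerationLeTwoOfTateTC
import HarnessLib

/-!
# T28b re-typing (`OfTateTC`: Tate's formula by name AT TOTALLY COMPLEX FIELDS) of `SignedBaseChangeAnticyclotomicEisensteinDivisibilityGreenbergFullAtSqueeze.lean`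

Route `EisensteinPrimes` (rung K5), crux 2 `GoodLatticeBDPValue` (stmt-BirchSwinnertonDyer-19032), line `halves`;
cell `bsd-eis`, seat `bsd-line-x1-p1` LEAD g8, lane «T28 / TATE RE-PLUMB» (helper, `--supports`).

This file re-types, token for token, the theorems of `SignedBaseChangeAnticyclotomicEisensteinDivisibilityGreenbergFullAtSqueeze` that carry
Greenberg 2006 Prop. 3.2 BY NAME (`h32 : (∀ (L : Type) [Field L] [NumberField L] [IsTotallyComplex L], Literature.NumberTheory.GaloisCohomology.tateGlobalEulerPoincareCharacteristic L)`, cofinite generation of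
`Hⁱ(K_Σ/K, 𝒟)` / `Hⁱ(K_v, 𝒟)` for EVERY `i`, every number field, every prime) with that hypothesis replaced by
Tate's global Euler–Poincaré characteristic BY NAME AT TOTALLY COMPLEX FIELDS
(`h32 : ∀ L [IsTotallyComplex L], GaloisCohomology.tateGlobalEulerPoincareCharacteristic L`, Milne ADT I Thm. 5.1 — the shape the
tree's class-formation road to Tate's theorem delivers; where a theorem's field was not syntactically totally complex an
`[IsTotallyComplex K]` binder is added and supplied by its callers from `IsImaginaryQuadratic K` / `∀ w, w.IsComplex`): on this line
Prop. 3.2 is read in degrees `i ≤ 2` only (global clause; the local clause is the unconditional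
`Greenberg2006.prop32_local_holds`), and in those degrees it follows from Tate's formula alone
(`Greenberg2006.prop32_global_le_two_of_tate_tc`, file `CohomologyCofiniteGenerationLeTwoOfTateTC`: `H⁰`/`H¹` of
`G_{K,S}` with finite coefficients are finite unconditionally, `H²` by Tate, and Greenberg's dévissage for `Hⁿ`
involves `Hⁿ`, `Hⁿ⁻¹` only).  Statements are otherwise VERBATIM (same binder order, new names `<name>_ofTateTC`; supersedes this seat's `…OfTate` twin, which took Tate's formula at every number field);
proofs are the tree proofs with the two reading lemmas substituted and the re-typed callees called.
EFFECT for the crux: Harari Thm. 17.13 (a) (`poitouTate_restricted_three_le`) is no longer consumed through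
Prop. 3.2 at every number field, only at totally complex fields (Greenberg 2006 Prop. 4.1 is typed totally
imaginary; `cd_p ≤ 2` and the `H²` bookkeeping at the imaginary quadratic `K`), which is what the tree's
class-formation road (`RestrictedRamificationCdTwoOfH3Mu`, lane PT3-TC) proves.

Theorems only; no definition, no named fact, no `sorry`, no instance. HONEST FRAMING: conditional on the PUBLISHED
named facts carried as hypotheses; closes nothing by itself; no summit statement / BSD / the crux is proved here.

## References
* R. Greenberg, *On the structure of certain Galois cohomology groups*, Doc. Math. Extra Vol. Coates (2006), Prop. 3.2 (p. 358). [Greenberg2006]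
* J. S. Milne, *Arithmetic Duality Theorems*, 2nd ed. (2006), I Thm. 5.1 (p. 67). [MilneADT2006]
* (the references of the re-typed file apply verbatim)
-/

-- `Summit.BirchSwinnertonDyer.BirchSwinnertonDyer.…`: summit and sub-problem share a name (D-0017 layout).
set_option autoImplicit false

noncomputable section

open scoped Classical
open NumberField IsDedekindDomain Field
open Literature.NumberTheory.GaloisRepresentations Literature.NumberTheory.IwasawaTheory
  Literature.NumberTheory.IwasawaTheory.Greenberg2016 Literature.NumberTheory.IwasawaTheory.Greenberg2006
  Summit.BirchSwinnertonDyer.BirchSwinnertonDyer.Theorems.GreenbergFullAtSelmer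
  Summit.BirchSwinnertonDyer.BirchSwinnertonDyer.Theorems.AcTwistDeformation

universe u

namespace Summit.BirchSwinnertonDyer.BirchSwinnertonDyer.Theorems.SignedBaseChangeAcDivGreenbergSqueeze

section Submodule

variable {Λ : Type u} [CommRing Λ] {M : Type u} [AddCommGroup M] [Module Λ M]

end Submodule

section QGlobal

variable {Λ : Type u} [CommRing Λ] {K : Type u} [Field K] [NumberField K]
  {S : Set (HeightOneSpectrum (𝓞 K))} [TopologicalSpace Λ] {D : Type u} [AddCommGroup D] [Module Λ D]
  [TopologicalSpace D] [DiscreteTopology D] [ContinuousSMul Λ D]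
  {ρ : ContinuousRep (GaloisGroupUnramifiedOutside K S) Λ D}

end QGlobal

section Squeeze

variable {p : ℕ} [Fact p.Prime] {K : Type} [Field K] [NumberField K]
  {S : Set (HeightOneSpectrum (𝓞 K))} {Λ' : Type} [CommRing Λ'] [IsDomain Λ'] [TopologicalSpace Λ']
  [IsTopologicalRing Λ'] {mΛ : ℕ}
  {D : Type} [AddCommGroup D] [Module Λ' D] [TopologicalSpace D] [DiscreteTopology D]
  [ContinuousSMul Λ' D] (ρ : ContinuousRep (GaloisGroupUnramifiedOutside K S) Λ' D)

/-- **[T28b `OfTateTC` re-typing: Greenberg 2006 Prop. 3.2 by name ↦ Milne ADT I Thm. 5.1 by name AT TOTALLY COMPLEX FIELDS (Prop. 3.2 is read in degrees ≤ 2 and at totally complex fields only, `prop32_global_le_two_of_tate_tc`).]** [cite: MilneADT2006, I Thm. 5.1 (p. 67)] **LEO(`𝐃`) ∧ CRK(`𝐃`, `𝓛_η`) ∧ `corank H¹(K_Σ/K, 𝐃) = m` ∧ `corank H²(K_Σ/K, 𝐃) = 0`, BY THE SQUEEZE,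
for a cofinitely generated `p`-primary `𝐃` of ANY corank `m`**, granted the PUBLISHED named facts
Greenberg 2006 Props. 3.2, 4.1, 4.2 and §5 A (hypotheses by name), for: `K` with every archimedean place
complex and `r₂ = 1`; `S ⊇ {v ∣ p}` finite whose places above `p` are among `η` and `η' ≠ η`, with `η' ∈ S` of
local degree one (`e·f = 1`); LOC_v⁽¹⁾ and `corank H⁰(K_v, 𝐃) = 0` at every finite `v ∈ S`;
`corank H⁰(K_Σ/K, 𝐃) = 0`; and `corank S_{𝓛_η}(K, 𝐃) = 0`. Chain: `corank H²(K_v, 𝐃) = 0` on `S`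
(§5 A ⟸ LOC⁽¹⁾); `corank H¹(K_{η'}, 𝐃) = m` (Prop. 4.2 (a) at a degree-one place) and cotorsion of
`H¹(K_v, 𝐃)` at `v ∤ p` (Prop. 4.2 (b)) and at `∞` (`Γ_ℂ = 1`); §2 `corank Q_{𝓛_η} = m`; cofinite generation
of `S_𝓛 ≤ H¹` and of `Q` (Prop. 3.2, §1); §3 the squeeze; LEO from `corank H² = 0`
(`AcTwistDeformation.leo_of_hasCorank_H2_zero_ofTateTC`); CRK from the three values (§2). This discharges the two
ARITHMETIC hypotheses of Greenberg 2016 Prop. 4.1.1 at the crux's instance `𝐃 = Ind_{K̃_∞/K}(E_K[p^∞])`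
(`m = 2`, `η = v`, `η' = v̄`) from `corank S_{𝓛_v} = 0` alone (⟸ `stub_torsionSS` by
`SignedBaseChangeAcDivFiniteExponent.hasCorank_zero_of_xGr₂_isTorsion`).
[cite: Greenberg2016Selmer, §2.2 p. 6, §2.3 p. 7 L1–17, Prop. 4.1.1 p. 15]
[cite: Greenberg2006, Prop. 3.2 p. 358; Props. 4.1, 4.2 (§4 A pp. 367–368); §5 A (p. 373)] -/
theorem leo_and_crk_fullAt_of_squeeze_ofTateTC
    (h41 : prop41_globalEulerPoincareCorank) (h42 : prop42_localEulerPoincareCorank)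
    (h32 : (∀ (L : Type) [Field L] [NumberField L] [IsTotallyComplex L], Literature.NumberTheory.GaloisCohomology.tateGlobalEulerPoincareCharacteristic L)) (h5A : sec5A_localH2_subsingleton_of_LOC1)
    (hSf : S.Finite) (hS : ∀ v : HeightOneSpectrum (𝓞 K), ((p : ℕ) : 𝓞 K) ∈ v.asIdeal → v ∈ S)
    (hK : ∀ w : InfinitePlace K, w.IsComplex) (hr₂ : InfinitePlace.nrComplexPlaces K = 1)
    (hΛ : Nonempty (Λ' ≃+* MvPowerSeries (Fin mΛ) ℤ_[p]))
    (hp : ∀ d : D, ∃ n : ℕ, (p ^ n : ℤ) • d = 0) (hcf : IsCofinitelyGenerated Λ' D)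
    {m : ℕ} (hm : HasCorank Λ' D m) (h0 : HasCorank Λ' (ρ.H 0) 0)
    {η η' : HeightOneSpectrum (𝓞 K)} (hη' : η' ∈ S) (hne : η' ≠ η)
    (hpη' : ((p : ℕ) : 𝓞 K) ∈ η'.asIdeal)
    (hdeg : η'.asIdeal.ramificationIdx ℤ * η'.asIdeal.inertiaDeg ℤ = 1)
    (hSp : ∀ v : HeightOneSpectrum (𝓞 K), v ∈ S → ((p : ℕ) : 𝓞 K) ∈ v.asIdeal → v = η ∨ v = η')
    (hLOC1 : ∀ v : HeightOneSpectrum (𝓞 K), v ∈ S → LOC1 S ρ (Sum.inr v))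
    (h0loc : ∀ v : HeightOneSpectrum (𝓞 K), v ∈ S → HasCorank Λ' ((localRep S ρ (Sum.inr v)).H 0) 0)
    (hSel : HasCorank Λ' (fullAtSpecification S ρ (Sum.inr η)).selmer 0) :
    LEO S ρ ∧ (fullAtSpecification S ρ (Sum.inr η)).CRK ∧
      HasCorank Λ' (ρ.H 1) m ∧ HasCorank Λ' (ρ.H 2) 0 := by
  haveI : IsTotallyComplex K := ⟨hK⟩
  -- cofinite generation everywhere (Prop. 3.2)
  have hcfg : ∀ (v : Place K) (i : ℕ), IsCofinitelyGenerated Λ' ((localRep S ρ v).H i) :=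
    fun v i ↦ prop32_local_of_holds hSf hS hΛ ρ hp hcf v i
  have hSelfg : IsCofinitelyGenerated Λ' (fullAtSpecification S ρ (Sum.inr η)).selmer :=
    isCofinitelyGenerated_submodule (prop32_global_le_two_of_tate_tc h32 hSf hS hΛ ρ hp hcf 1) _
  -- local coranks: `h²_v = 0` on `S` (§5 A), `h¹_{η'} = m` (Prop. 4.2 (a)), cotorsion elsewhere
  have h2loc : ∀ v : HeightOneSpectrum (𝓞 K), v ∈ S →
      HasCorank Λ' ((localRep S ρ (Sum.inr v)).H 2) 0 := fun v hv ↦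
    hasCorank_localH2_zero_of_sec5A ρ h5A hSf hS hΛ hp hcf (hLOC1 v hv)
  have hη'm : HasCorank Λ' ((localRep S ρ (Sum.inr η')).H 1) m :=
    hasCorank_localH1_of_prop42_degree_one ρ h42 hSf hS hΛ hp hcf hpη' hdeg hm (h0loc η' hη')
      (h2loc η' hη')
  have hcot : ∀ v : Place K, InSigma S v → v ≠ Sum.inr η → v ≠ Sum.inr η' →
      IsCotorsion Λ' ((localRep S ρ v).H 1) := by
    rintro (w | v) hv h1 h2'
    · exact isCotorsion_localH1_inl_of_isComplex S ρ (hK w)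
    · have hvS : v ∈ S := (inSigma_inr_iff S v).mp hv
      have hvη : v ≠ η := fun h ↦ h1 (by rw [h])
      have hvη' : v ≠ η' := fun h ↦ h2' (by rw [h])
      have hvp : ((p : ℕ) : 𝓞 K) ∉ v.asIdeal := fun h ↦ by
        rcases hSp v hvS h with h' | h'
        · exact hvη h'
        · exact hvη' h'
      exact isCotorsion_localH1_of_prop42 ρ h42 hSf hS hΛ hp hcf hvp hm (h0loc v hvS) (h2loc v hvS)
        (hcfg (Sum.inr v) 1)
  -- `Q_{𝓛_η}`: corank `m`, cofinitely generated
  have hQ : HasCorank Λ' (fullAtSpecification S ρ (Sum.inr η)).QGlobal m :=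
    hasCorank_QGlobal_fullAt_of_corank hSf hη' hne hη'm hcot
  have hQfg : IsCofinitelyGenerated Λ' (fullAtSpecification S ρ (Sum.inr η)).QGlobal :=
    isCofinitelyGenerated_QGlobal_fullAt hSf η fun v _ ↦ hcfg v 1
  -- the squeeze
  obtain ⟨hH1, hH2⟩ := hasCorank_H1_and_H2_zero_of_corank ρ h41 hSf hS hK hr₂ hΛ hp hcf hm h0
    (fullAtSpecification S ρ (Sum.inr η)) hSel hSelfg hQ hQfg
  exact ⟨leo_of_hasCorank_H2_zero_ofTateTC ρ h32 hSf hS hΛ hp hcf hH2,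
    CRK_fullAt_of_coranks_of_corank hSf hη' hne hH1 hSel hη'm hcot, hH1, hH2⟩

end Squeeze

section H0Local

variable {Λ : Type u} [CommRing Λ] {M N : Type u} [AddCommGroup M] [Module Λ M] [AddCommGroup N]
  [Module Λ N]

variable {p : ℕ} [Fact p.Prime] {K : Type} [Field K] [NumberField K]
  {S : Set (HeightOneSpectrum (𝓞 K))} {Λ' : Type} [CommRing Λ'] [IsDomain Λ'] [TopologicalSpace Λ']
  [IsTopologicalRing Λ']
  {D : Type} [AddCommGroup D] [Module Λ' D] [TopologicalSpace D] [DiscreteTopology D]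
  [IsTopologicalAddGroup D] [ContinuousSMul Λ' D] (ρ : ContinuousRep (GaloisGroupUnramifiedOutside K S) Λ' D)

end H0Local

end Summit.BirchSwinnertonDyer.BirchSwinnertonDyer.Theorems.SignedBaseChangeAcDivGreenbergSqueeze

end
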